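import Mathlib.RingTheory.Ideal.MinimalPrime.Noetherian
import Mathlib.RingTheory.Polynomial.Basic
import Literature.NumberTheory.Transcendental.ExpPointsExamples
import HarnessLib

/-!
# Sparsity at `n = 2`: reduction to ℚ-irreducible varieties

`sparsity_iff_prime`: the statement SPARSITY(2) ("every `W ⊆ ℂ² × ℂ²` defined over the prime field
with `zariskiDim ℂ W < 2` has finitely many ℚ-linearly independent exponential points", the crux
`SparsityTwo` of the Schanuel routes) is equivalent to its restriction to zero loci `Z(𝔮)` of PRIME
ideals `𝔮 ⊆ ℚ[x₁, x₂, y₁, y₂]`: `Z(I)` is the union of the zero loci of the finitely many minimal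
primes of `I` (`zeroLocus_eq_iUnion_minimalPrimes`; Noetherianity of the polynomial ring and
`Ideal.exists_minimalPrimes_le` applied to the prime of a point), each of which is ℚ-defined and
contained in `Z(I)`. So any proof of the crux may assume `W` ℚ-irreducible (a finite Galois orbit of
algebraic points, or an irreducible ℚ-curve whose complex components are conjugate). Sorry-free;
no named fact.

## References
* D. Marker, *A remark on Zilber's pseudoexponentiation*, J. Symbolic Logic 71 (2006), §1.
-/

namespace Literature.NumberTheory.Transcendental

open MvPolynomial Complex

noncomputable section

variable {ι : Type}

/-- A zero locus defined over a subfield is the union of the zero loci of the minimal primes of its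
defining ideal (finitely many: the polynomial ring is Noetherian). [folklore] -/
theorem zeroLocus_eq_iUnion_minimalPrimes {F : Subfield ℂ} (I : Ideal (MvPolynomial ι F)) :
    zeroLocus ℂ I = ⋃ q ∈ I.minimalPrimes, zeroLocus ℂ q := by
  apply Set.Subset.antisymm
  · intro P hP
    -- the prime of `P`
    let J : Ideal (MvPolynomial ι F) := RingHom.ker (MvPolynomial.aeval P).toRingHom
    haveI : J.IsPrime := RingHom.ker_isPrime _
    have hIJ : I ≤ J := fun f hf => by
      rw [RingHom.mem_ker]
      exact hP f hf
    obtain ⟨q, hq, hqJ⟩ := Ideal.exists_minimalPrimes_le hIJ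
    refine Set.mem_iUnion₂.mpr ⟨q, hq, fun f hf => ?_⟩
    have := hqJ hf
    rwa [RingHom.mem_ker] at this
  · intro P hP
    obtain ⟨q, hq, hPq⟩ := Set.mem_iUnion₂.mp hP
    exact fun f hf => hPq f (hq.1.2 hf)

/-- **WLOG `W` is ℚ-irreducible**: sparsity at `n = 2` for all `W` defined over ℚ with
`zariskiDim ℂ W < 2` follows from (indeed is equivalent to) the case `W = Z(𝔮)` for PRIME ideals
`𝔮` of `ℚ[x₁, x₂, y₁, y₂]` (decompose `Z(I)` into the zero loci of the finitely many minimal primes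
of `I`; each is ℚ-defined, contained in `Z(I)`, hence of dimension `< 2`). [folklore] -/
theorem sparsity_iff_prime :
    (∀ W : Set (Fin 2 ⊕ Fin 2 → ℂ), IsDefinedOver (⊥ : Subfield ℂ) W → zariskiDim ℂ W < 2 →
        (indepExpPoints W).Finite) ↔
      ∀ q : Ideal (MvPolynomial (Fin 2 ⊕ Fin 2) (⊥ : Subfield ℂ)), q.IsPrime →
        zariskiDim ℂ (zeroLocus ℂ q) < 2 → (indepExpPoints (zeroLocus ℂ q)).Finite := by
  constructor
  · intro h q _ hd
    exact h _ ⟨q, rfl⟩ hd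
  · rintro h W ⟨I, rfl⟩ hd
    have hfin : I.minimalPrimes.Finite := Ideal.finite_minimalPrimes_of_isNoetherianRing _ I
    have hunion : indepExpPoints (zeroLocus ℂ I) =
        ⋃ q ∈ I.minimalPrimes, indepExpPoints (zeroLocus ℂ q) := by
      ext x
      simp only [indepExpPoints, Set.mem_setOf_eq, Set.mem_iUnion]
      constructor
      · rintro ⟨hx, hW⟩
        rw [zeroLocus_eq_iUnion_minimalPrimes] at hW
        obtain ⟨q, hq, hxq⟩ := Set.mem_iUnion₂.mp hW
        exact ⟨q, hq, hx, hxq⟩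
      · rintro ⟨q, hq, hx, hxq⟩
        refine ⟨hx, ?_⟩
        rw [zeroLocus_eq_iUnion_minimalPrimes]
        exact Set.mem_iUnion₂.mpr ⟨q, hq, hxq⟩
    rw [hunion]
    refine Set.Finite.biUnion hfin fun q hq => h q hq.1.1 (lt_of_le_of_lt ?_ hd)
    refine zariskiDim_mono ?_
    rw [zeroLocus_eq_iUnion_minimalPrimes I]
    exact Set.subset_iUnion₂ (s := fun q _ => zeroLocus ℂ q) q hq

end

end Literature.NumberTheory.Transcendental
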